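import Literature.Geometry.Lorentzian.Stability
import Literature.Geometry.Lorentzian.StabilityCauchy
import HarnessLib

/-!
# Barrier catalogue `FinalStateConjecture`: nonlinear Kerr stability is proved only for slow rotation
(`Literature/Barriers/FinalStateConjecture/`, D-0021; family `gr`, summit `FinalStateConjecture`;
namespace `Literature.Barriers.FinalStateConjecture`)

This file records, as a **frontier barrier**, the printed reach of the nonlinear asymptotic
stability theory of the Kerr family, on which clause (ii) of the final state conjecture
(`Literature.Geometry.Lorentzian.Development.SettlesToKerrFamily`, `FinalState.lean`) rests: the theorem of
Klainerman–Szeftel and Giorgi–Klainerman–Szeftel (with Shen) is stated and proved only under the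
hypothesis "for sufficiently small `|a₀|/m₀`", and the authors' own account localises the use of
that hypothesis in the energy–Morawetz estimates of GKS, Parts II–III.

* `KerrStabilityHoldsBelow α` — the consequence-form conclusion of the vendored fact
  `Literature.Geometry.Lorentzian.klainerman_szeftel_kerr_stability_small_a` (`Stability.lean`, gr.S05) demanded for
  **all** spins `|a| < α M` (threshold form; the printed theorems give an inexplicit `α > 0`;
  the printed sub-extremal Kerr stability conjecture, Dafermos–Rodnianski Conj. 5.1, is the case
  `α = 1`; the tree's formal version of that conjecture, gr.S04
  `Literature.GR.SubextremalKerrStabilityConjecture s δ k`, differs from `KerrStabilityHoldsBelow 1` in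
  its conclusion — `∀ η ∃ ε` with `|M' − M| + |a' − a| ≤ η` and a `RemainsCloseToKerr` clause
  versus `∃ ε ∃ C` with the linear bound `C · dist` — and neither implies the other as
  formalised). `KerrStabilityHoldsBelow 1` is the strongest instance (`.of_one`) and `α ≤ 0` is
  vacuous (`_of_nonpos`), both proved.
* `SlowlyRotatingKerrFrontier := ∃ α > 0, KerrStabilityHoldsBelow α` — **the barrier
  declaration** (structured `technique_class / blocks / because / evasions_known / status`
  block in its docstring), definitionally a reshuffling of the gr.S05 fact
  (`slowlyRotatingKerrFrontier_iff`, proved), hence exactly as strong as its source.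
* `KerrStabilityHoldsBelow.mono` (antitone in `α`), `KerrStabilityHoldsBelow_of_nonpos`,
  `KerrStabilityHoldsBelow.of_one`, `slowlyRotatingKerrFrontier_of` (proved API).

* `KerrStabilityHoldsBelowNarrow α` — **barrier audit 2026-08-15 (D-0021): the non-vacuous
  replacement family**, verbatim `KerrStabilityHoldsBelow α` over the repaired development structure
  `VacuumCauchyDevelopment D`, `IsMaximal` (`CauchyDevelopment.lean`) with far-origin completeness in
  the ported form `DataEmbedding.HasCompleteFutureNullInfinityFar` and the printed parameter modulus
  `C · √dist` (`StabilityCauchy.lean`); its docstring carries the **updated barrier block**. Proved API: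
  `.mono`, `_of_nonpos`, `.of_one`, `.nearness`, `exists_kerrStabilityHoldsBelowNarrow_iff` (the
  frontier instance `∃ α > 0, KerrStabilityHoldsBelowNarrow α` is a quantifier reshuffling of the
  faithful gr.S05 re-vendoring
  `Literature.Geometry.Lorentzian.klainerman_szeftel_kerr_stability_small_a_cauchy`), `_of`,
  `_iff_eventually`. **Audit findings**, in brief (details in that docstring): (i) the original family
  `KerrStabilityHoldsBelow α` quantifies over the uninhabited prelude structure `VacuumDevelopment` and
  therefore holds for **every** `α` by elimination from `False` (`KerrStabilityHoldsBelow_holds`,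
  `SlowlyRotatingKerrFrontier_holds`, sibling file `SlowlyRotatingKerrFrontierProofs`): the object the
  original block names as blocked, `KerrStabilityHoldsBelow 1`, is a theorem of the vendored definitions
  and blocks nothing; (ii) the frontier itself has **moved in the literature**: nonlinear stability of
  the Kerr family in the full sub-extremal range `|a| < M` is claimed by Hintz, arXiv:2606.28253 (v2 of
  2026-08-03), Thm. 1.1 and Thm. 13.1, by a microlocal / generalized-wave-map-gauge / Nash–Moser proof
  with the Andersson–Häfner–Whiting mode stability as a black box, after Häfner–Hintz–Vasy's
  unconditional linear stability in the full range (arXiv:2506.21183), while the energy–Morawetz step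
  of GKS — the only place where the Klainerman–Szeftel proof uses `|a| ≪ M` — has itself been extended
  to perturbations of Kerr in the full range by Ma–Szeftel (scalar waves arXiv:2410.02341, Teukolsky
  arXiv:2603.23437); (iii) the original `because` clause ("separation-based methods are incompatible
  with the nonlinear setting") is contradicted in print by Dafermos–Holzegel–Rodnianski–Taylor's
  black-box scheme (Analysis & PDE 19 (2026) 909, §1.4.4). The original declarations and their block are
  kept verbatim (D-0014) with `scope_caveats` (f)–(h) and the `status` line amended to point here.

Nothing here is asserted beyond the sources: the `Prop`s restate Klainerman–Szeftel, PAMQ 19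
(2023), Thm. 1.2.1 / Main Theorem §3.4.3, in the consequence form already reviewed in
`Stability.lean` (same carrier: horizon-penetrating Kerr–Schild slices `Kerr.slice a r₀`,
`r₋ < r₀ < r₊`, weighted Sobolev closeness to `Kerr.data M a r₀`, maximal vacuum developments,
`HasCompleteFutureNullInfinityFar`, `Spacetime.ConvergesToKerr`); the barrier docstring quotes
Klainerman, C. R. Mécanique 353 (2025), §2.5, §3.2, §4.3.6–4.3.7 and GKS §1.3.2 for the mechanism
and Dafermos–Rodnianski–Shlapentokh-Rothman (2016) et al. for the known evasions at the linear
level. Instance hypotheses `[Kerr.Facts] [Kerr.SliceFacts]` exactly as in `Stability.lean`.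

## References

* S. Klainerman, J. Szeftel, *Kerr stability for small angular momentum*, Pure Appl. Math. Q. 19
  (2023) 791–1678, Thm. 1.2.1 (p. 22), Main Theorem §3.4.3, (3.4.8).
* E. Giorgi, S. Klainerman, J. Szeftel, *Wave equations estimates and the nonlinear stability of
  slowly rotating Kerr black holes*, arXiv:2205.14808 (PAMQ 20 (2024) 2865–3849), Thm. 1.3.2 and
  §1.3.2, items 1–7 (pp. 31–34).
* S. Klainerman, *The black hole stability problem*, C. R. Mécanique 353 (2025) 555–581, §2.5
  (p. 562), §3.2 (p. 566), Thm. 4.1 (p. 569), §4.3.6–§4.3.7 (p. 576).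
* M. Dafermos, I. Rodnianski, Y. Shlapentokh-Rothman, *Decay for solutions of the wave equation
  on Kerr exterior spacetimes III: the full subextremal case |a| < M*, Ann. of Math. 183 (2016)
  787–913, §1.1 (pp. 3–8).
* M. Dafermos, I. Rodnianski, *Lectures on black holes and linear waves*, arXiv:0811.0354,
  Conj. 5.1 and §4.5.
* Y. Shlapentokh-Rothman, R. Teixeira da Costa, arXiv:2007.07211 and arXiv:2302.08916 (Teukolsky
  on Kerr, full subextremal range).
* P. Hintz, *Nonlinear stability of subextremal Kerr black holes*, arXiv:2606.28253 (v2,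
  2026-08-03), Abstract, Thm. 1.1 and footnote 1 (p. 2), Remark 1.3 (p. 3), §1.1 (p. 4), Remark 1.4
  (p. 5), Thm. 13.1 (pp. 318–319), Remarks 13.2–13.3 (pp. 319–320); companions *Constraint damping on
  subextremal Kerr spacetimes*, arXiv:2606.27658, and *(Non-)Linear waves on asymptotically flat
  spacetimes II*, arXiv:2606.28008.
* D. Häfner, P. Hintz, A. Vasy, *Linear stability of Kerr black holes in the full subextremal range*,
  arXiv:2506.21183 (2025), Abstract and Thm. 1.1 (p. 1), §1 (p. 3).
* S. Ma, J. Szeftel, *Energy-Morawetz estimates for the wave equation in perturbations of Kerr*,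
  arXiv:2410.02341 (v2, 2026), Abstract (p. 1), §1.1.3 (p. 3), §1.2.5 (p. 6), Thm. 1.4 and Remark 1.5
  (p. 7); *Energy-Morawetz estimates for Teukolsky equations in perturbations of Kerr*,
  arXiv:2603.23437 (2026), Abstract (p. 1), §1.1 (p. 4).
* M. Dafermos, G. Holzegel, I. Rodnianski, M. Taylor, *Quasilinear wave equations on asymptotically
  flat spacetimes with applications to Kerr black holes*, Analysis & PDE 19 (2026) 909–1028
  (arXiv:2212.14093), §1 (p. 4), §1.4.1–1.4.2 (p. 13), §1.4.4 (p. 16); *Quasilinear wave equations on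
  Kerr black holes in the full subextremal range |a| < M*, arXiv:2410.03639.
* L. Andersson, D. Häfner, B. F. Whiting, *Mode analysis for the linearized Einstein equations on the
  Kerr metric: the large 𝔞 case*, arXiv:2207.12952.
* P. Millet, *Optimal decay for solutions of the Teukolsky equation on the Kerr metric for the full
  subextremal range |a| < M*, arXiv:2302.06946.
* L. He, S. Klainerman, *A physical space derivation of Morawetz–energy estimates in Kerr spacetimes
  with large angular momentum*, arXiv:2607.08958 (2026), Abstract (p. 1).
* P. Hintz, O. Petersen, A. Vasy, *Conditional non-linear stability of Kerr–de Sitter spacetimes in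
  the full subextremal range*, arXiv:2508.06620 (2025), Abstract.
-/

noncomputable section

open Set
open scoped Manifold ContDiff ENNReal

namespace Literature.Barriers.FinalStateConjecture

open Literature.Geometry.Lorentzian

/-- **The Klainerman–Szeftel conclusion below the spin threshold `α`.** For Sobolev/decay
exponents and a derivative order `(s, δ, k)` (existential, as in gr.S05): for all Kerr parameters
`0 < M`, `|a| < α M` and every inner radius `r₀ ∈ (r₋, r₊)` there are `ε > 0` and `C` such that
every solution `D` of the vacuum constraints on the horizon-penetrating Kerr–Schild slice
`Kerr.slice a r₀` which is `ε`-close to the induced Kerr data `Kerr.data M a r₀` in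
`H^s_δ × H^{s-1}_{δ+1}` has all its maximal globally hyperbolic vacuum developments possessing
complete future null infinity (far-origin sojourn form `HasCompleteFutureNullInfinityFar`) and a
region converging in `Cᵏ` to a nearby subextremal Kerr exterior `g_{M',a'}`
(`Spacetime.ConvergesToKerr`) with `|M' − M| + |a' − a| ≤ C · dist`. This is the body of the
vendored fact `Literature.Geometry.Lorentzian.klainerman_szeftel_kerr_stability_small_a` (`Stability.lean`) with its
existential threshold `a₀` replaced by the parameter `α`; all paraphrase conventions are those
documented there. Klainerman–Szeftel, PAMQ 19 (2023), Thm. 1.2.1 and Main Theorem §3.4.3, (3.4.8)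
(the printed theorem is the case "`α` sufficiently small"); Dafermos–Rodnianski, arXiv:0811.0354,
Conj. 5.1 (the printed conjecture is the case `α = 1`; the tree's gr.S04 differs in its
conclusion, see the module docstring). **Degenerate regimes** (both proved below): for `α ≤ 0`
the predicate is vacuously true (`|a| < α M` is unsatisfiable when `0 < M`;
`KerrStabilityHoldsBelow_of_nonpos`), and `KerrStabilityHoldsBelow 1` already implies
`KerrStabilityHoldsBelow α` for **every** `α` (`KerrStabilityHoldsBelow.of_one`), because for
`|a| ≥ M` the prelude's junk convention `√(M² − a²) = 0` gives `r₋ = r₊ = M`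
(`Kerr.rMinus`, `Kerr.rPlus`), so the inner-radius clause `r₀ ∈ (r₋, r₊)` is empty; thus
`α = 1` (the full sub-extremal range) is the strongest instance.
[cite: KlainermanSzeftel2023, Thm. 1.2.1 and Main Theorem §3.4.3] [cite: DafermosRodnianski2008, Conj. 5.1] -/
def KerrStabilityHoldsBelow [Kerr.Facts] [Kerr.SliceFacts] (α : ℝ) : Prop :=
  ∃ (s : ℕ) (δ : ℝ) (k : ℕ), ∀ (M a : ℝ) (hM : 0 < M), |a| < α * M →
    ∀ r₀ ∈ Set.Ioo (Kerr.rMinus M a) (Kerr.rPlus M a), ∃ ε > (0 : ℝ), ∃ C : ℝ,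
      ∀ (D : InitialDataSet 𝓘(ℝ, E3) (Kerr.slice a r₀)) [D.metric.HasLeviCivita],
        D.IsVacuumConstraintSolution →
        InitialDataSet.dataWeightedSobolevEDist s δ D (Kerr.data M a r₀ hM.le) <
          ENNReal.ofReal ε →
        ∀ 𝒟 : VacuumDevelopment D, 𝒟.IsMaximal →
          ∃ (M' a' : ℝ) (𝒟oc : Set 𝒟.carrier), Kerr.IsSubextremal M' a' ∧
            HasCompleteFutureNullInfinityFar 𝒟.toDevelopment ∧
            𝒟.toSpacetime.ConvergesToKerr 𝒟oc M' a' k ∧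
            |M' - M| + |a' - a| ≤ C *
              (InitialDataSet.dataWeightedSobolevEDist s δ D (Kerr.data M a r₀ hM.le)).toReal

/-- `KerrStabilityHoldsBelow` is antitone in the threshold: the conclusion for all `|a| < β M`
gives it for all `|a| < α M` when `α ≤ β` (since `0 < M`). [folklore] -/
theorem KerrStabilityHoldsBelow.mono [Kerr.Facts] [Kerr.SliceFacts] {α β : ℝ} (hαβ : α ≤ β)
    (h : KerrStabilityHoldsBelow β) : KerrStabilityHoldsBelow α := by
  obtain ⟨s, δ, k, h⟩ := h
  exact ⟨s, δ, k, fun M a hM ha ↦ h M a hM (ha.trans_le (by gcongr))⟩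

/-- Degenerate regime (i): for `α ≤ 0` the threshold predicate is vacuously true, since
`|a| < α M` is unsatisfiable when `0 < M` (witness exponents `(0, 0, 0)`). [folklore] -/
theorem KerrStabilityHoldsBelow_of_nonpos [Kerr.Facts] [Kerr.SliceFacts] {α : ℝ} (hα : α ≤ 0) :
    KerrStabilityHoldsBelow α := by
  refine ⟨0, 0, 0, fun M a hM ha r₀ _ ↦ ?_⟩
  exfalso
  nlinarith [abs_nonneg a]

/-- Degenerate regime (ii): the instance `α = 1` (all sub-extremal spins `|a| < M`) implies every
other instance, because for `|a| ≥ M` the junk convention `√(M² − a²) = 0` of `Kerr.rPlus` /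
`Kerr.rMinus` makes `r₋ = r₊ = M`, so no inner radius `r₀ ∈ (r₋, r₊)` exists and the clause is
empty. Hence `KerrStabilityHoldsBelow 1` is the strongest instance — the formal object a barrier
audit should attack. [folklore] -/
theorem KerrStabilityHoldsBelow.of_one [Kerr.Facts] [Kerr.SliceFacts] (h : KerrStabilityHoldsBelow 1)
    (α : ℝ) : KerrStabilityHoldsBelow α := by
  obtain ⟨s, δ, k, h⟩ := h
  refine ⟨s, δ, k, fun M a hM _ r₀ hr₀ ↦ ?_⟩
  by_cases hsub : |a| < M
  · exact h M a hM (by rwa [one_mul]) r₀ hr₀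
  · exfalso
    have hMa : M ≤ |a| := not_lt.1 hsub
    have hsq : M ^ 2 - a ^ 2 ≤ 0 := by
      have h1 : M ^ 2 ≤ |a| ^ 2 := by gcongr
      rw [sq_abs] at h1
      linarith
    have h0 : √(M ^ 2 - a ^ 2) = 0 := Real.sqrt_eq_zero'.2 hsq
    have h₁ := hr₀.1
    have h₂ := hr₀.2
    simp only [Kerr.rMinus, Kerr.rPlus, h0, sub_zero, add_zero] at h₁ h₂
    exact lt_irrefl _ (h₁.trans h₂)

/-- **Barrier (frontier of the printed theory): nonlinear asymptotic stability of the Kerr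
exterior is proved only for slowly rotating black holes, `|a|/M ≪ 1`.** As printed
(Klainerman–Szeftel, PAMQ 19 (2023), Thm. 1.2.1; Giorgi–Klainerman–Szeftel, arXiv:2205.14808,
Thm. 1.3.2; Klainerman, C. R. Mécanique 353 (2025), Thm. 4.1): "The future globally hyperbolic
development of a general, asymptotically flat, initial data set, sufficiently close (in a
suitable topology) to a Kerr(a₀, m₀) initial data set, for sufficiently small `|a₀|/m₀`, has a
complete future null infinity `𝓘⁺` and converges in its causal past `J⁻(𝓘⁺)` to another nearby
Kerr spacetime Kerr(a_∞, m_∞) with parameters (a_∞, m_∞) close to the initial ones (a₀, m₀)."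
Recorded in threshold form, `∃ α > 0, KerrStabilityHoldsBelow α`; this is a reshuffling of the
quantifiers of the vendored gr.S05 fact `Literature.Geometry.Lorentzian.klainerman_szeftel_kerr_stability_small_a`
(`slowlyRotatingKerrFrontier_iff`), so the declaration is exactly as strong as its source. The
threshold `α` is not explicit in the sources.

BARRIER (D-0021; every clause is a quotation or close paraphrase of the cited locus):
* technique_class: kerr-stability, perturbation-of-Kerr, small-angular-momentum, vectorfield-method, energy-morawetz, physical-space, GCM, bootstrap
* blocks: `KerrStabilityHoldsBelow 1` — the Klainerman–Szeftel conclusion for ALL sub-extremal spins `|a| < M`, the strongest instance of the threshold family (`KerrStabilityHoldsBelow.of_one`) and the formal object to attack — is not covered by the printed theorems ("Though the full sub-extremal range |a| < m remains open", [cite: Klainerman2025, §4.3.7]); likewise `KerrStabilityHoldsBelow α` for any explicit `α > 0`; separately (a formally different statement, neither implying the other as formalised: `∀ η ∃ ε`, nearness `≤ η`, `RemainsCloseToKerr` versus `∃ ε ∃ C`, linear bound) the tree's gr.S04 `Literature.GR.SubextremalKerrStabilityConjecture s δ k`, whose printed source is the case `α = 1` [cite: DafermosRodnianski2008, Conj.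 5.1]; a fortiori clause (ii) of the final state conjecture (`Literature.Geometry.Lorentzian.Development.SettlesToKerrFamily`, whose final holes are only required to satisfy `|aᵢ| ≤ Mᵢ`) is not covered by the printed stability theorems whenever a final hole is not slowly rotating.
* because: "a large part of the proof of stability does not require the smallness of |a|/m. This is the case for [KS 2023; KS, GCM spheres; Shen]. In fact the smallness assumption is only needed in [GKS], mostly in the derivation of the main energy–morawetz estimates in parts II and III" [cite: Klainerman2025, §4.3.7 (p. 576)]; these estimates rest on "an extension of the Andersson–Blue method [...] to spin-2 wave equations in suitable perturbations of Kerr" [cite: GiorgiKlainermanSzeftel2022, §1.3.2 item 2 (p. 32)], "a purely physical space proof of the Energy–Morawetz estimate for small |a/m|" adopted because it "is robust with respect to perturbations" [cite: Klainerman2025, §3.2 (pp. 566–567)]; the classical vectorfield method "is known to fail for general solutions in Kerr, see Alinhac", the derivation "in the full sub-extremal case |a| < m is even more subtle and was achieved by Dafermos–Rodnianski–Shlapentokh-Rothman by combining the vectorfield method with a full separation of variables approach" [cite: Klainerman2025, §3.2 (p. 566)], and "methods based on separation of variables, developed to treat scalar and spin 2 wave equations in Kerr, are incompatible with the nonlinear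 setting which requires, instead, robust methods to derive decay" [cite: Klainerman2025, §2.5 (6) (p. 562)]; at the linear level the role of smallness is that "superradiance is controlled by a small parameter (the case |a| ≪ M)", whereas for general `|a| < M` "since we do not have a small parameter" the bounded-frequency superradiant horizon term is controlled only through the quantitative refinement of Whiting's mode stability [cite: DafermosRodnianskiShlapentokhrothman2014, §1.1 (pp. 3, 6–7) and §9.7 (p. 51)].
* evasions_known: only at the LINEAR level on the full sub-extremal range `|a| < M`: scalar waves, boundedness and decay (vendored: `Literature.Geometry.Lorentzian.drsr_wave_boundedness_kerr`, `Literature.Geometry.Lorentzian.drsr_wave_polynomial_decay_kerr`) [cite: DafermosRodnianskiShlapentokhrothman2014, Thm. 3.1 and Cor. 3.1]; the Teukolsky equation, frequency-space and physical-space analyses [cite: ShlapentokhrothmanCosta2020] [cite: ShlapentokhrothmanCosta2023]; generalized Regge–Wheeler/Teukolsky decay results "recently extended to the full subextremal range" [cite: Klainerman2025, §3.4 (p. 567)]; a Morawetz estimate for scalar waves in the full sub-extremal case in Stogin's thesis [cite: Klainerman2025, fn. 35 (p. 566)]. No nonlinear result beyond `|a| ≪ M` is recorded in the sources ("remains open",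 [cite: Klainerman2025, §4.3.7]).
* scope_caveats: (a) the threshold `α` is inexplicit in every source ("sufficiently small `|a₀|/m₀`"), so no explicit spin ratio is certified either way; (b) the formal declarations are the consequence-form paraphrase of gr.S05 (`Stability.lean`: truncated horizon-penetrating Kerr–Schild slices `Kerr.slice a r₀`, weighted-Sobolev closeness with existential exponents, no decay rates, no gauge or GCM statement), not the printed theorem verbatim; (c) `SlowlyRotatingKerrFrontier` itself is a POSITIVE statement, equivalent to the vendored gr.S05 fact (`slowlyRotatingKerrFrontier_iff`) — the obstruction ("remains open", smallness needed in GKS Parts II–III) is docstring-level, and the attackable formal object for a barrier audit is `KerrStabilityHoldsBelow 1` (or any explicit `α`), which nothing printed decides; (d) degenerate regimes of the threshold family: `α ≤ 0` is vacuously true and `α ≥ 1` adds nothing to `α = 1` (`KerrStabilityHoldsBelow_of_nonpos`, `.of_one`); (e) the sources assert no impossibility theorem for the physical-space method at large `|a|/m` — only that the present proof uses smallness there and that separation-based methods are "incompatible with the nonlinear setting" [cite: Klainerman2025, §2.5 (6)]; (f) (audit 2026-08-15) VACUITY: `KerrStabilityHoldsBelow α` quantifies `∀ 𝒟 : VacuumDevelopment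 D` over the uninhabited prelude structure (`Literature.Geometry.Lorentzian.Development.elim`), so every instance — `α = 1` included — and `SlowlyRotatingKerrFrontier` hold by elimination from `False` (`KerrStabilityHoldsBelow_holds`, `SlowlyRotatingKerrFrontier_holds` in `SlowlyRotatingKerrFrontierProofs`); the formal object named in `blocks:` blocks nothing, and the non-vacuous replacement is `KerrStabilityHoldsBelowNarrow` below; (g) (audit) MODULUS: the linear bound `C · dist` is stronger than what is printed (`C · √dist`, Klainerman–Szeftel (3.4.7)–(3.4.8), as recorded in `Literature.Geometry.Lorentzian.klainerman_szeftel_kerr_stability_small_a_cauchy`); the replacement uses `√`; (h) (audit) the frontier recorded in `blocks:`/`evasions_known:` ("No nonlinear result beyond `|a| ≪ M`", "remains open") is OUT OF DATE as of 2026-06: see the `blocks:`, `because:` and `evasions_known:` clauses of `KerrStabilityHoldsBelowNarrow` [cite: Hintz2026, Thm. 1.1 (p. 2)] [cite: MaSzeftel2024, Remark 1.5 (p. 7)] [cite: DafermosHolzegelRodnianskiTaylor2022, §1.4.4 (p. 16)].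
* status: established as a POSITIVE statement — the frontier statement is a theorem in print [cite: KlainermanSzeftel2023, Thm. 1.2.1] [cite: GiorgiKlainermanSzeftel2022, Thm. 1.3.2], and that its method requires small `|a|/m` exactly in GKS Parts II–III is the authors' printed account [cite: Klainerman2025, §4.3.7]; SUPERSEDED as a barrier (audit 2026-08-15): formally vacuous ((f)), and the printed frontier has moved to the full sub-extremal range [cite: Hintz2026, Thm. 1.1 (p. 2) and Thm. 13.1 (pp. 318–319)] (preprint) — the current block is that of `KerrStabilityHoldsBelowNarrow`. -/
def SlowlyRotatingKerrFrontier [Kerr.Facts] [Kerr.SliceFacts] : Prop :=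
  ∃ α > (0 : ℝ), KerrStabilityHoldsBelow α

/-- The frontier statement is (a quantifier reshuffling of) the vendored Klainerman–Szeftel fact
gr.S05: `∃ α > 0, ∃ (s, δ, k), …` versus `∃ (s, δ, k), ∃ a₀ > 0, …`. Klainerman–Szeftel, PAMQ 19
(2023), Thm. 1.2.1. [cite: KlainermanSzeftel2023, Thm. 1.2.1] -/
theorem slowlyRotatingKerrFrontier_iff [Kerr.Facts] [Kerr.SliceFacts] :
    SlowlyRotatingKerrFrontier ↔ klainerman_szeftel_kerr_stability_small_a := by
  constructor
  · rintro ⟨α, hα, s, δ, k, h⟩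
    exact ⟨s, δ, k, α, hα, h⟩
  · rintro ⟨s, δ, k, α, hα, h⟩
    exact ⟨α, hα, s, δ, k, h⟩

/-- The vendored Klainerman–Szeftel fact yields the frontier statement (one direction of
`slowlyRotatingKerrFrontier_iff`, for consumers holding `(h : klainerman_szeftel_…)`).
Klainerman–Szeftel, PAMQ 19 (2023), Thm. 1.2.1. [cite: KlainermanSzeftel2023, Thm. 1.2.1] -/
theorem slowlyRotatingKerrFrontier_of [Kerr.Facts] [Kerr.SliceFacts]
    (h : klainerman_szeftel_kerr_stability_small_a) : SlowlyRotatingKerrFrontier :=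
  slowlyRotatingKerrFrontier_iff.2 h

/-- Below any positive threshold covered by the frontier, every smaller threshold is covered
(`KerrStabilityHoldsBelow.mono`); in particular the frontier statement is equivalent to
`KerrStabilityHoldsBelow α` holding for all sufficiently small `α > 0`. [folklore] -/
theorem slowlyRotatingKerrFrontier_iff_eventually [Kerr.Facts] [Kerr.SliceFacts] :
    SlowlyRotatingKerrFrontier ↔ ∃ α₀ > (0 : ℝ), ∀ α ∈ Set.Ioc 0 α₀, KerrStabilityHoldsBelow α := by
  constructor
  · rintro ⟨α₀, hα₀, h⟩
    exact ⟨α₀, hα₀, fun α hα ↦ h.mono hα.2⟩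
  · rintro ⟨α₀, hα₀, h⟩
    exact ⟨α₀, hα₀, h α₀ ⟨hα₀, le_rfl⟩⟩

/-! ### Barrier audit 2026-08-15 (D-0021): the non-vacuous replacement family and the moved frontier -/

/-- **The Kerr-stability conclusion below the spin threshold `α` — non-vacuous re-vendoring over the
repaired development structure** (the `…Narrow` replacement of `KerrStabilityHoldsBelow`, barrier
audit 2026-08-15, D-0021). Verbatim `KerrStabilityHoldsBelow α` with two corrections, both forced by
audits recorded elsewhere in the tree: (1) the developments quantified over are the **maximal vacuum
Cauchy developments** `𝒟 : VacuumCauchyDevelopment D`, `𝒟.IsMaximal` of `CauchyDevelopment.lean`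
(O'Neill's Cauchy-hypersurface notion; inhabited, and supplied for constraint-solving data by the
named fact `Literature.Geometry.Lorentzian.choquetBruhat_geroch_exists_mghd_cauchy`), with far-origin
completeness of `𝓘⁺` in the ported form `DataEmbedding.HasCompleteFutureNullInfinityFar`
(`StabilityCauchy`) — instead of the prelude's `VacuumDevelopment D`, which is uninhabited
(`Literature.Geometry.Lorentzian.Development.elim`), so that `KerrStabilityHoldsBelow α` holds for
every `α` by elimination from `False` (`KerrStabilityHoldsBelow_holds`, sibling file
`SlowlyRotatingKerrFrontierProofs`) and blocks nothing; (2) the parameter modulus is `C · √dist`, as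
printed (Klainerman–Szeftel (3.4.7)–(3.4.8) give `≤ C ε₀` for layers of size `𝔍 ≤ ε₀²`), exactly as
in the faithful re-vendoring `klainerman_szeftel_kerr_stability_small_a_cauchy` of gr.S05, of which
the frontier instance `∃ α > 0, KerrStabilityHoldsBelowNarrow α` is a quantifier reshuffling
(`exists_kerrStabilityHoldsBelowNarrow_iff`). Degenerate regimes as before
(`KerrStabilityHoldsBelowNarrow_of_nonpos`, `.of_one`, `.mono`): `α ≤ 0` is vacuous and `α = 1`
(all sub-extremal spins) is the strongest instance.

BARRIER (D-0021; replaces the block of `SlowlyRotatingKerrFrontier`; every clause is a quotation or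
close paraphrase of the cited locus):
* technique_class: kerr-stability, perturbation-of-Kerr, small-angular-momentum, vectorfield-method, energy-morawetz, physical-space, GCM, bootstrap — and, the class through which the frontier moved: microlocal, spectral-resolvent, generalized-wave-map-gauge, Nash–Moser, constraint-damping, mode-stability-black-box
* blocks: as of 2026-08-15, NOTHING in the perturbative sub-extremal regime if [Hin26b] stands: the instance `KerrStabilityHoldsBelowNarrow 1` (all `|a| < M`; the object the original block named as blocked, "Though the full sub-extremal range |a| < m remains open" [cite: Klainerman2025, §4.3.7 (p. 576)]) is claimed, in the consequence form recorded here (caveat (b)), by Hintz: "We settle the global nonlinear stability problem for the family of Kerr black holes in the full subextremal range" [cite: Hintz2026, Abstract], Thm. 1.1: for sub-extremal `b₀ = (m₀, a₀)` and constraint-satisfying `(γ, k)` close to `(γ_{b₀}, k_{b₀})` "there exist subextremal parameters b = (m, a) close to b₀ such that the MGHD of (Σ, γ, k) contains a region isometric to (Ω, g)", `Ω = {t̃ ≥ 0, r ≥ m₀}` — a horizon-penetrating slab, `r₋ < m₀ < r₊`, cf. `Kerr.slice a m₀` — with `|g − g_b| ≲ (1 + t̃)^{-2-ε_K}` on compact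 sets and quantitative decay "in all asymptotic regions of Ω", and "This settles the Kerr stability conjecture in the full subextremal range" [cite: Hintz2026, Thm. 1.1 (p. 2)]; precise version Thm. 13.1: data `γ − γ_{b₀} ∈ H_b^{∞,(E₀,3+ε₀)}`, `k − k_{b₀} ∈ H_b^{∞,(E₀+1,4+ε₀)}` small in `H_b^d`, conclusion `Ric(g) = 0` on `φ_S(Ω)` attaining the data, with the rates (1) `O(t_*^{-2-ε_K})` on spatially compact sets, …, (4) `O(r⁻¹)` for `r/t_* ≥ C` [cite: Hintz2026, Thm. 13.1 (pp. 318–319)]. What the moved frontier still does NOT cover: (i) extremal `|a| = M` — the phase-space structure used "hold[s] throughout the subextremal range (but not on extremal Kerr, where |a| = m)" [cite: Hintz2026, Remark 1.4 (p. 5)] (see `ExtremalHorizonInstability`); (ii) structureless slowly decaying data — Thm. 13.1 needs partial polyhomogeneity or `O(r^{-3-ε₀})` decay, and removing this "cannot be done using only the ideas introduced in the present paper … new ideas will be required" [cite: Hintz2026, Remark 1.3 (p. 3)], while the printed small-`|a|` theorems take structureless `O(r^{-3/2-ε₀})` data and neither result implies the other [cite: Hintz2026, footnote 1 (p. 2)];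 (iii) anything non-perturbative: clause (ii) of the final state conjecture (`Literature.Geometry.Lorentzian.Development.SettlesToKerrFamily`) for generic data far from every Kerr data set is untouched by all of the above.
* because: the ORIGINAL mechanism — smallness of `|a|/m` "is only needed in [GKS], mostly in the derivation of the main energy–morawetz estimates in parts II and III" [cite: Klainerman2025, §4.3.7 (p. 576)], separation-of-variables methods being "incompatible with the nonlinear setting which requires, instead, robust methods to derive decay" [cite: Klainerman2025, §2.5 (6) (p. 562)] — is contradicted in print on both counts. (a) Energy–Morawetz estimates "in spacetimes with metrics that are perturbations, compatible with nonlinear applications, of Kerr metrics in the full subextremal range" are proved for scalar waves [cite: MaSzeftel2024, Abstract (p. 1) and Thm. 1.4 (p. 7)] — "the assumption |a| ≪ m is only needed in [GKS] for the derivation of the main energy-Morawetz estimates for the scalar wave equation, Teukolsky equations, and Bianchi identities in perturbations of Kerr" [cite: MaSzeftel2024, Remark 1.5 (p. 7)], "the analysis for wave equations in perturbations of Kerr beyond the slowly rotating case is an open problem and the focus of the present paper" [cite: MaSzeftel2024, §1.2.5 (p. 6)] — and for the Teukolsky equations [cite: MaSzeftel2026, Abstract (p. 1)], by microlocal multipliers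 adapted to the `r`-foliation. (b) Frequency-localised linear estimates enter nonlinear problems as black boxes: "there is absolutely nothing to fear in these type of frequency localisations for nonlinear applications … can thus in principle be used directly for the nonlinear problem, in fact, as 'black box' results" [cite: DafermosHolzegelRodnianskiTaylor2022, §1.4.4 (p. 16)]; "our main theorem immediately applies to semilinear equations on Kerr in the full subextremal range |a| < M" [cite: DafermosHolzegelRodnianskiTaylor2022, §1 (p. 4)]; quasilinear equations on Kerr, full range [cite: DafermosHolzegelRodnianskiTaylor2024, Abstract]. (c) The frontier was moved by a proof outside the physical-space/vectorfield class altogether — generalized wave-map gauge with finite-dimensional gauge-source unknowns, Nash–Moser iteration, microlocal tame estimates and zero-energy resolvent analysis, the mode stability of Andersson–Häfner–Whiting "used here as a black box" [cite: Hintz2026, Remark 1.4 (p. 5)] — resting on linear stability proved "unconditionally … in the full subextremal range" [cite: HafnerHintzVasy2025, Abstract (p. 1)].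
* evasions_known: full sub-extremal range, LINEAR: scalar waves, boundedness and decay [cite: DafermosRodnianskiShlapentokhrothman2014, Thm. 3.1 and Cor. 3.1]; Teukolsky [cite: ShlapentokhrothmanCosta2020] [cite: ShlapentokhrothmanCosta2023] [cite: Millet2023]; mode stability of linearised gravity [cite: AnderssonHafnerWhiting2022]; linear stability of the Kerr family [cite: HafnerHintzVasy2025, Thm. 1.1 (p. 1)]; physical-space Morawetz–energy on exact Kerr "in the range |a|/m ≤ 0.75" [cite: HeKlainerman2026, Abstract (p. 1)]. NONLINEAR MODEL PROBLEMS, full range: semilinear and (axisymmetric) quasilinear waves [cite: DafermosHolzegelRodnianskiTaylor2022, §1.4.1–1.4.2 (p. 13)], general quasilinear waves [cite: DafermosHolzegelRodnianskiTaylor2024, Abstract]; robust energy–Morawetz on perturbations of Kerr [cite: MaSzeftel2024, Thm. 1.4 (p. 7)] [cite: MaSzeftel2026, Abstract (p. 1)]. NONLINEAR EINSTEIN VACUUM, full range: Kerr [cite: Hintz2026, Thm. 1.1 (p. 2) and Thm. 13.1 (pp. 318–319)] (preprint, v2 of 2026-08-03, with companions arXiv:2606.27658 and arXiv:2606.28008;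 unrefereed at the audit date); Kerr–de Sitter, conditionally on mode stability [cite: HintzPetersenVasy2025, Abstract].
* scope_caveats: (a) consequence-form paraphrase exactly as gr.S05-cauchy (`StabilityCauchy`): truncated horizon-penetrating Kerr–Schild slices `Kerr.slice a r₀`, existential exponents `(s, δ, k)`, no decay rates, no gauge statement; (b) `KerrStabilityHoldsBelowNarrow 1` is NOT asserted as a fact here and is not [Hin26b] verbatim: Thm. 13.1 is stated on one Cauchy hypersurface `{t_IVP = 0} ∩ {r ≥ m₀}` for b-Sobolev data classes `H_b^{d,(E₀,3+ε₀)}`, whereas the family asks every inner radius `r₀ ∈ (r₋, r₊)` (other hypersurfaces: [cite: Hintz2026, Remark 13.3 (pp. 319–320)]) and an `H^s_δ`-ball with existential `(s, δ)` (for large `δ` the ball consists of structureless fast-decaying perturbations, the case `E₀ = ∅` of Thm. 13.1); sojourn-form completeness of `𝓘⁺` is a consequence of the `O(r⁻¹)` control near `𝓘⁺` (Thm. 13.1 (4)), not a printed clause; vendoring [Hin26b] as a named fact is Literature tenure (`Stability*.lean`), after which `KerrStabilityHoldsBelowNarrow 1` is to be derived from it; (c) inside the vectorfield/physical-space class proper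 the nonlinear threshold stays inexplicit ("sufficiently small |a₀|/m₀") and the scalar-wave threshold on exact Kerr is `|a|/m ≤ 0.75` [cite: HeKlainerman2026, Abstract (p. 1)]; (d) degenerate regimes: `α ≤ 0` vacuous, `α ≥ 1` adds nothing to `α = 1` (`KerrStabilityHoldsBelowNarrow_of_nonpos`, `.of_one`); (e) non-vacuity is relative: inhabitation of `VacuumCauchyDevelopment D` with `IsMaximal` for the data in the ball rests on the named facts `choquetBruhat_geroch_exists_mghd_cauchy` and `Kerr.data_isVacuumConstraintSolution`, not proved in the tree.
* status: superseded (the frontier moved) — the slowly-rotating instance `∃ α > 0, KerrStabilityHoldsBelowNarrow α` is a refereed theorem in print [cite: KlainermanSzeftel2023, Thm. 1.2.1] [cite: GiorgiKlainermanSzeftel2022, Thm. 1.3.2]; the full-range instance `α = 1` is claimed in preprint [cite: Hintz2026, Thm. 1.1 (p. 2)]; the original block's "remains open" [cite: Klainerman2025, §4.3.7 (p. 576)] and its mechanism clause are out of date as of 2026-06. -/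
def KerrStabilityHoldsBelowNarrow [Kerr.Facts] [Kerr.SliceFacts] (α : ℝ) : Prop :=
  ∃ (s : ℕ) (δ : ℝ) (k : ℕ), ∀ (M a : ℝ) (hM : 0 < M), |a| < α * M →
    ∀ r₀ ∈ Set.Ioo (Kerr.rMinus M a) (Kerr.rPlus M a), ∃ ε > (0 : ℝ), ∃ C : ℝ,
      ∀ (D : InitialDataSet 𝓘(ℝ, E3) (Kerr.slice a r₀)) [D.metric.HasLeviCivita],
        D.IsVacuumConstraintSolution →
        InitialDataSet.dataWeightedSobolevEDist s δ D (Kerr.data M a r₀ hM.le) <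
          ENNReal.ofReal ε →
        ∀ 𝒟 : VacuumCauchyDevelopment D, 𝒟.IsMaximal →
          ∃ (M' a' : ℝ) (𝒟oc : Set 𝒟.carrier), Kerr.IsSubextremal M' a' ∧
            𝒟.HasCompleteFutureNullInfinityFar ∧
            𝒟.toSpacetime.ConvergesToKerr 𝒟oc M' a' k ∧
            |M' - M| + |a' - a| ≤ C *
              √(InitialDataSet.dataWeightedSobolevEDist s δ D (Kerr.data M a r₀ hM.le)).toReal

/-- `KerrStabilityHoldsBelowNarrow` is antitone in the threshold: the conclusion for all `|a| < β M`
gives it for all `|a| < α M` when `α ≤ β` (since `0 < M`). [folklore] -/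
theorem KerrStabilityHoldsBelowNarrow.mono [Kerr.Facts] [Kerr.SliceFacts] {α β : ℝ} (hαβ : α ≤ β)
    (h : KerrStabilityHoldsBelowNarrow β) : KerrStabilityHoldsBelowNarrow α := by
  obtain ⟨s, δ, k, h⟩ := h
  exact ⟨s, δ, k, fun M a hM ha ↦ h M a hM (ha.trans_le (by gcongr))⟩

/-- Degenerate regime (i) of the replacement family: for `α ≤ 0` the threshold predicate is
vacuously true, since `|a| < α M` is unsatisfiable when `0 < M` (witness exponents `(0, 0, 0)`).
[folklore] -/
theorem KerrStabilityHoldsBelowNarrow_of_nonpos [Kerr.Facts] [Kerr.SliceFacts] {α : ℝ}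
    (hα : α ≤ 0) : KerrStabilityHoldsBelowNarrow α := by
  refine ⟨0, 0, 0, fun M a hM ha r₀ _ ↦ ?_⟩
  exfalso
  nlinarith [abs_nonneg a]

/-- Degenerate regime (ii) of the replacement family: the instance `α = 1` (all sub-extremal spins
`|a| < M`) implies every other instance, because for `|a| ≥ M` the junk convention `√(M² − a²) = 0`
of `Kerr.rPlus` / `Kerr.rMinus` makes `r₋ = r₊ = M`, so no inner radius `r₀ ∈ (r₋, r₊)` exists.
Hence `KerrStabilityHoldsBelowNarrow 1` is the strongest instance — the formal object whose printed
status moved from "remains open" (Klainerman, C. R. Mécanique 353 (2025), §4.3.7) to "settled"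
(Hintz, arXiv:2606.28253, Thm. 1.1) between the filing of this barrier and its audit. [folklore] -/
theorem KerrStabilityHoldsBelowNarrow.of_one [Kerr.Facts] [Kerr.SliceFacts]
    (h : KerrStabilityHoldsBelowNarrow 1) (α : ℝ) : KerrStabilityHoldsBelowNarrow α := by
  obtain ⟨s, δ, k, h⟩ := h
  refine ⟨s, δ, k, fun M a hM _ r₀ hr₀ ↦ ?_⟩
  by_cases hsub : |a| < M
  · exact h M a hM (by rwa [one_mul]) r₀ hr₀
  · exfalso
    have hMa : M ≤ |a| := not_lt.1 hsub
    have hsq : M ^ 2 - a ^ 2 ≤ 0 := by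
      have h1 : M ^ 2 ≤ |a| ^ 2 := by gcongr
      rw [sq_abs] at h1
      linarith
    have h0 : √(M ^ 2 - a ^ 2) = 0 := Real.sqrt_eq_zero'.2 hsq
    have h₁ := hr₀.1
    have h₂ := hr₀.2
    simp only [Kerr.rMinus, Kerr.rPlus, h0, sub_zero, add_zero] at h₁ h₂
    exact lt_irrefl _ (h₁.trans h₂)

/-- **The slowly-rotating frontier over the repaired structure is (a quantifier reshuffling of) the
faithful gr.S05 re-vendoring** `klainerman_szeftel_kerr_stability_small_a_cauchy` (`StabilityCauchy`):
`∃ α > 0, ∃ (s, δ, k), …` versus `∃ (s, δ, k), ∃ a₀ > 0, …`. This is the non-vacuous counterpart of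
`slowlyRotatingKerrFrontier_iff`. Klainerman–Szeftel, PAMQ 19 (2023), Thm. 1.2.1 and Main Theorem
§3.4.3, (3.4.7)–(3.4.8). [cite: KlainermanSzeftel2023, Thm. 1.2.1] -/
theorem exists_kerrStabilityHoldsBelowNarrow_iff [Kerr.Facts] [Kerr.SliceFacts] :
    (∃ α > (0 : ℝ), KerrStabilityHoldsBelowNarrow α) ↔
      klainerman_szeftel_kerr_stability_small_a_cauchy := by
  constructor
  · rintro ⟨α, hα, s, δ, k, h⟩
    exact ⟨s, δ, k, α, hα, h⟩
  · rintro ⟨s, δ, k, α, hα, h⟩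
    exact ⟨α, hα, s, δ, k, h⟩

/-- The faithful Klainerman–Szeftel fact yields the slowly-rotating instance of the replacement family
(one direction of `exists_kerrStabilityHoldsBelowNarrow_iff`, for consumers holding
`(h : klainerman_szeftel_kerr_stability_small_a_cauchy)`). Klainerman–Szeftel, PAMQ 19 (2023),
Thm. 1.2.1. [cite: KlainermanSzeftel2023, Thm. 1.2.1] -/
theorem exists_kerrStabilityHoldsBelowNarrow_of [Kerr.Facts] [Kerr.SliceFacts]
    (h : klainerman_szeftel_kerr_stability_small_a_cauchy) :
    ∃ α > (0 : ℝ), KerrStabilityHoldsBelowNarrow α :=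
  exists_kerrStabilityHoldsBelowNarrow_iff.2 h

/-- Below any positive threshold covered, every smaller threshold is covered
(`KerrStabilityHoldsBelowNarrow.mono`); so the slowly-rotating frontier over the repaired structure is
equivalent to `KerrStabilityHoldsBelowNarrow α` for all sufficiently small `α > 0`. [folklore] -/
theorem exists_kerrStabilityHoldsBelowNarrow_iff_eventually [Kerr.Facts] [Kerr.SliceFacts] :
    (∃ α > (0 : ℝ), KerrStabilityHoldsBelowNarrow α) ↔
      ∃ α₀ > (0 : ℝ), ∀ α ∈ Set.Ioc 0 α₀, KerrStabilityHoldsBelowNarrow α := by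
  constructor
  · rintro ⟨α₀, hα₀, h⟩
    exact ⟨α₀, hα₀, fun α hα ↦ h.mono hα.2⟩
  · rintro ⟨α₀, hα₀, h⟩
    exact ⟨α₀, hα₀, h α₀ ⟨hα₀, le_rfl⟩⟩

/-- **Thm. 1.2.1's qualitative nearness, at every covered threshold**: if the replacement family holds
below `α`, then for `|a| < α M`, `r₀ ∈ (r₋, r₊)` and every tolerance `η > 0` the data ball can be
shrunk (to radius `min ε (η / max C 1)²`) so that the final parameters satisfy
`|M' − M| + |a' − a| ≤ η` — the `∀ η, ∃ ε` form of Dafermos–Rodnianski's Conj. 5.1 as rendered by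
gr.S04, over the repaired structure. For `α = 1` this is the qualitative full-range statement.
Klainerman–Szeftel, PAMQ 19 (2023), Thm. 1.2.1; Dafermos–Rodnianski, arXiv:0811.0354, Conj. 5.1.
[cite: DafermosRodnianski2008, Conj. 5.1] -/
theorem KerrStabilityHoldsBelowNarrow.nearness [Kerr.Facts] [Kerr.SliceFacts] {α : ℝ}
    (h : KerrStabilityHoldsBelowNarrow α) :
    ∃ (s : ℕ) (δ : ℝ) (k : ℕ), ∀ (M a : ℝ) (hM : 0 < M), |a| < α * M →
      ∀ r₀ ∈ Set.Ioo (Kerr.rMinus M a) (Kerr.rPlus M a), ∀ η > (0 : ℝ), ∃ ε > (0 : ℝ),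
        ∀ (D : InitialDataSet 𝓘(ℝ, E3) (Kerr.slice a r₀)) [D.metric.HasLeviCivita],
          D.IsVacuumConstraintSolution →
          InitialDataSet.dataWeightedSobolevEDist s δ D (Kerr.data M a r₀ hM.le) <
            ENNReal.ofReal ε →
          ∀ 𝒟 : VacuumCauchyDevelopment D, 𝒟.IsMaximal →
            ∃ (M' a' : ℝ) (𝒟oc : Set 𝒟.carrier), Kerr.IsSubextremal M' a' ∧
              |M' - M| + |a' - a| ≤ η ∧
              𝒟.HasCompleteFutureNullInfinityFar ∧
              𝒟.toSpacetime.ConvergesToKerr 𝒟oc M' a' k := by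
  obtain ⟨s, δ, k, H⟩ := h
  refine ⟨s, δ, k, fun M a hM ha r₀ hr₀ η hη ↦ ?_⟩
  obtain ⟨ε, hε, C, HD⟩ := H M a hM ha r₀ hr₀
  have hC : 0 < max C 1 := lt_max_of_lt_right one_pos
  refine ⟨min ε ((η / max C 1) ^ 2), lt_min hε (pow_pos (div_pos hη hC) 2),
    fun D _ hvac hdist 𝒟 hmax ↦ ?_⟩
  have hdε : InitialDataSet.dataWeightedSobolevEDist s δ D (Kerr.data M a r₀ hM.le) <
      ENNReal.ofReal ε :=
    hdist.trans_le (ENNReal.ofReal_le_ofReal (min_le_left _ _))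
  obtain ⟨M', a', 𝒟oc, hsub, hnull, hconv, hpar⟩ := HD D hvac hdε 𝒟 hmax
  refine ⟨M', a', 𝒟oc, hsub, hpar.trans ?_, hnull, hconv⟩
  set d := (InitialDataSet.dataWeightedSobolevEDist s δ D (Kerr.data M a r₀ hM.le)).toReal
  have hd : d < (η / max C 1) ^ 2 :=
    (ENNReal.lt_ofReal_iff_toReal_lt hdist.ne_top).1
      (hdist.trans_le (ENNReal.ofReal_le_ofReal (min_le_right _ _)))
  have hsd : √d < η / max C 1 := (Real.sqrt_lt' (div_pos hη hC)).2 hd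
  calc C * √d ≤ max C 1 * √d := mul_le_mul_of_nonneg_right (le_max_left C 1) (Real.sqrt_nonneg _)
    _ ≤ max C 1 * (η / max C 1) := mul_le_mul_of_nonneg_left hsd.le hC.le
    _ = η := mul_div_cancel₀ η hC.ne'


end Literature.Barriers.FinalStateConjecture

end
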